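/-
Copyright: the b2b-balaban T⁴-continuum CRUX team, row NE7b leaf lineage `t4-ne7b-formalise-leaf-06` (gen 153). Project licence.
-/
import Mathlib.Analysis.SpecialFunctions.Trigonometric.Basic
import Mathlib.Topology.Algebra.InfiniteSum.Basic

/-!
# THE INFINITELY SUPPORTED LATTICE SYMBOL OF A CUBIC-SYMMETRIC KERNEL IS CUBIC-SYMMETRIC: `Φ(p) = Σ'_{x ∈ ℤ^ι} k x·cos(Σ_i x_i p_i)`
# is invariant under the coordinate sign flips and permutations of `p` as soon as the weights `k` are — by REINDEXING the series along
# the dual index symmetry (`Equiv.tsum_eq`: no summability needed), so `…CubicSymmetricKernelMarginal` §3 applies to infinite-range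
# kernels (row NE7b, node U5c; the `Σ'` companion of `…CubicSymmetricKernelMarginal` §4; [folklore])

Cell `pub-balaban`, sub-cell `t4`, spine estimate NE7b (`T4WeightBudget.RelWeightBound`; the cell's OWN estimate — NOT PRINTED in
[Bałaban 1983–89], NOT PROVED).  Crux-route work under `Spine/NE7b/` by a row leaf on the convexity road under FREEZE (0)'s crux-prover
clause; NOTHING of Bałaban's is named or asserted; no `T4Continuum/Support` leaf typed; no `def`; zero `sorry`.  Imports: Mathlib only
(`…CubicSymmetricKernelMarginal` (CSKM, p379216 ✓), `…LatticeSymbolHessianLetters` (LSHL, p379373 ✓) and `…LatticeKernelMomentsSummable`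
(LKMS, p379372 ✓) have no hub olean at the time of writing; nothing of theirs imported or restated — CSKM §4 is the FINITE sum `Σ_{x∈s}`,
this file the series `Σ'`).

WHY.  CSKM types IHPC's letter (S) from cubic symmetry: §3 `hessian_diag_eq_mul_sum_sq` turns flip- and permutation-invariance of a
scalar kernel `Φ` on `ι → ℝ` into `D²Φ(0)[q,q] = b·Σ_j q_j²`, and §4 discharges the two invariances for LKM's FINITELY supported lattice
symbol.  Print's inherited kernels have infinite range (tree decay; LKMS ∕ LSHL type the `Σ'` symbol's letters), so the (S) supplier must
cover `Φ(p) = Σ'_x k x·cos⟨x, p⟩`.  For a series the transport by an index symmetry is even simpler than for a finite sum: an `Equiv` of the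
index type reindexes ANY `tsum`, convergent or not (`Equiv.tsum_eq`) — no support bookkeeping, no summability letter.  THIS FILE: the
transport lemma, the two instances (flips are self-dual coordinatewise; the dual of `p ↦ p ∘ σ` is `x ↦ x ∘ σ⁻¹`), so that CSKM §3's two
hypotheses hold for the `Σ'` symbol of every flip- and permutation-invariant `k` — the END `D²Φ(0)[q,q] = D²Φ(0)[e_{i₀},e_{i₀}]·Σ_j q_j²` is then
CSKM §3 BY NAME (one `exact`; olean-gated, certificate by source concat until then).

WHAT IS PROVED ([folklore]; `ι` a finite type with decidable equality, `k : (ι → ℤ) → ℝ`, the symbol written inline as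
`fun p => Σ' x, k x * cos (Σ i, (x i : ℝ) * p i)`):
* §1 **`tsumSymbol_eq_of_symmetry`** — an index equivalence `g` with `k ∘ g = k` and DUAL to the momentum map (`⟨g x, p⟩ = ⟨x, p′⟩`)
  transports the symbol: `Φ(p′) = Φ(p)` (`Equiv.tsum_eq`, no summability).
* §2 **`tsumSymbol_flip_invariant`** (`k (update x j (−x j)) = k x` for all `x` ⟹ `Φ (update p j (−p j)) = Φ p`) and
  **`tsumSymbol_perm_invariant`** (`k (x ∘ σ) = k x` for all `σ, x` ⟹ `Φ (p ∘ σ) = Φ p`; dual index map `x ↦ x ∘ σ⁻¹` via `Equiv.arrowCongr`).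
* §3 toy (kernel): the zero kernel is cubic-symmetric and its symbol is `0` (`example`).

NOT HERE (honest): the END itself (CSKM §3 BY NAME, olean-gated); summability ∕ regularity of the `Σ'` symbol (LKMS ∕ LSHL); form-valued
kernels; WHICH kernels of print's are cubic-symmetric ((A3) ∕ (A1c), NC-NE7b-α UNRULED); anything of Bałaban's.  BY-NAME EFFECT ON THE
WALL: NONE.  NE7b NOT PRINTED ∕ NOT PROVED; spine PROVED 0∕9; rung (B)+1 on a FINITE torus — NOT infinite volume, NOT the mass gap, NOT
Clay.  HONEST DEPENDENCY: continuum YM on T⁴ ⇐ BetaPertH ∧ nine spine estimates (0∕9 proved); BetaPertH ⇐ (D1) ∧ (D4) ∧ CAP+tail; G-an2-4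
gates asym, D1 and NE2∕3∕4.
-/

set_option autoImplicit false

noncomputable section

open Function Real

namespace Summit.QuantumFields.BalabanUV.T4Continuum.NE7b.CubicSymmetricLatticeSymbolSummable

variable {ι : Type*} [Fintype ι]

/-! ## §1 Transport of the series by an index symmetry dual to the momentum map -/

/-- **TRANSPORT BY AN INDEX SYMMETRY** (no summability asked): `g` an equivalence of `ι → ℤ` with `k (g x) = k x` and
`Σ_i (g x)_i p_i = Σ_i x_i p′_i` for all `x` ⟹ `Σ' x, k x·cos(Σ_i x_i p′_i) = Σ' x, k x·cos(Σ_i x_i p_i)` (`Equiv.tsum_eq`). [folklore] -/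
theorem tsumSymbol_eq_of_symmetry {k : (ι → ℤ) → ℝ} (g : (ι → ℤ) ≃ (ι → ℤ)) (hk : ∀ x, k (g x) = k x) {p p' : ι → ℝ}
    (hdual : ∀ x : ι → ℤ, ∑ i, ((g x i : ℤ) : ℝ) * p i = ∑ i, ((x i : ℤ) : ℝ) * p' i) :
    ∑' x : ι → ℤ, k x * cos (∑ i, ((x i : ℤ) : ℝ) * p' i) = ∑' x : ι → ℤ, k x * cos (∑ i, ((x i : ℤ) : ℝ) * p i) := by
  calc ∑' x : ι → ℤ, k x * cos (∑ i, ((x i : ℤ) : ℝ) * p' i)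
      = ∑' x : ι → ℤ, k (g x) * cos (∑ i, ((g x i : ℤ) : ℝ) * p i) := tsum_congr fun x => by rw [hk, hdual]
    _ = ∑' y : ι → ℤ, k y * cos (∑ i, ((y i : ℤ) : ℝ) * p i) :=
        g.tsum_eq fun y : ι → ℤ => k y * cos (∑ i, ((y i : ℤ) : ℝ) * p i)

/-! ## §2 The two instances: coordinate sign flips and coordinate permutations -/

section Instances

variable [DecidableEq ι]

/-- **COORDINATE SIGN FLIPS**: weights invariant under `x ↦ update x j (−x j)` ⟹ the `Σ'` symbol is invariant under
`p ↦ update p j (−p j)` (the flip is a self-dual involution, coordinatewise). [folklore] -/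
theorem tsumSymbol_flip_invariant {k : (ι → ℤ) → ℝ} (hk : ∀ (j : ι) (x : ι → ℤ), k (update x j (-x j)) = k x) (j : ι)
    (p : ι → ℝ) :
    ∑' x : ι → ℤ, k x * cos (∑ i, ((x i : ℤ) : ℝ) * update p j (-p j) i)
      = ∑' x : ι → ℤ, k x * cos (∑ i, ((x i : ℤ) : ℝ) * p i) := by
  have hinv : Involutive fun x : ι → ℤ => update x j (-x j) := fun x => by
    funext i; by_cases hij : i = j
    · subst hij; simp
    · simp [hij]
  refine tsumSymbol_eq_of_symmetry hinv.toPerm (fun x => hk j x) fun x => Finset.sum_congr rfl fun i _ => ?_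
  show (((update x j (-x j)) i : ℤ) : ℝ) * p i = ((x i : ℤ) : ℝ) * update p j (-p j) i
  by_cases hij : i = j
  · subst hij; simp
  · simp [hij]

omit [DecidableEq ι] in
/-- **COORDINATE PERMUTATIONS**: weights invariant under every `x ↦ x ∘ σ` ⟹ the `Σ'` symbol is invariant under every
`p ↦ p ∘ σ` (the dual index map is `x ↦ x ∘ σ⁻¹`, an equivalence by `Equiv.arrowCongr`). [folklore] -/
theorem tsumSymbol_perm_invariant {k : (ι → ℤ) → ℝ} (hk : ∀ (σ : Equiv.Perm ι) (x : ι → ℤ), k (x ∘ σ) = k x)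
    (σ : Equiv.Perm ι) (p : ι → ℝ) :
    ∑' x : ι → ℤ, k x * cos (∑ i, ((x i : ℤ) : ℝ) * (p ∘ σ) i) = ∑' x : ι → ℤ, k x * cos (∑ i, ((x i : ℤ) : ℝ) * p i) := by
  have hg : ∀ x : ι → ℤ, (Equiv.arrowCongr σ (Equiv.refl ℤ)) x = x ∘ σ.symm := fun x => by
    funext i; simp [Equiv.arrowCongr_apply]
  refine tsumSymbol_eq_of_symmetry (Equiv.arrowCongr σ (Equiv.refl ℤ)) (fun x => by rw [hg]; exact hk σ.symm x) fun x => ?_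
  rw [hg]
  exact (Fintype.sum_equiv σ (fun m => ((x m : ℤ) : ℝ) * (p ∘ σ) m) (fun i => (((x ∘ σ.symm) i : ℤ) : ℝ) * p i)
    fun m => by simp).symm

end Instances

/-! ## §3 Toy (kernel) -/

/-- The zero kernel is cubic-symmetric; its `Σ'` symbol is invariant (and is `0`). -/
example [DecidableEq ι] (j : ι) (p : ι → ℝ) :
    ∑' x : ι → ℤ, (fun _ : ι → ℤ => (0 : ℝ)) x * cos (∑ i, ((x i : ℤ) : ℝ) * update p j (-p j) i)
      = ∑' x : ι → ℤ, (fun _ : ι → ℤ => (0 : ℝ)) x * cos (∑ i, ((x i : ℤ) : ℝ) * p i) :=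
  tsumSymbol_flip_invariant (k := fun _ => (0 : ℝ)) (fun _ _ => rfl) j p

end Summit.QuantumFields.BalabanUV.T4Continuum.NE7b.CubicSymmetricLatticeSymbolSummable

end
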